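import Literature.NumberTheory.Transcendental.ExpLogSimultaneousApproximationMeasure
import Mathlib.LinearAlgebra.Matrix.Determinant.Basic
import Mathlib.Data.Fintype.Prod

/-!
# RootDecomp1KNW96Gap — lens 6, generation 22 «NW96-THM1 GAP»

HOME kernel of `decomp-schanuel-lens-6` gen 22 (PATH T: HOME-only, sorry-free, against the LIVE route
`route-Schanuel-RootDecomp1K`; nothing here is a ledger write; no item of the route closes).

SUBJECT: the registered Literature NAMED FACT
`Literature.NumberTheory.Transcendental.NesterenkoWaldschmidt1996_thm_1` (Nesterenko–Waldschmidt, Mat. Zapiski 2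
(1996) 23–42 = arXiv:math/0002047, Theorem 1 = Main Theorem, constant `211`), consumed as a binder `(hNW : …)` by the
tree theorems `RootDecomp1KGeneric13/16/20`, `RootDecomp1KFiniteOrderCell01/04`, `RootDecomp1KKummerClosure05`,
`RootDecomp1KDarkLogSq02` and `RootDecomp1ETwoScale02/08/09`.

FINDING (reading the printed proof, arXiv version §6 pp. 5–6, for a by-name discharge):

1. **Lemma 6 as printed is false at every admissible parameter point** (§1–§3 below, kernel-checked).  It asserts
   `L = (T+1)(2T₁+1)` rows `(σ_μ, s_μ)` with `0 ≤ σ_μ ≤ S`, `0 ≤ s_μ ≤ S₁` and a NON-VANISHING `L × L` determinant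
   `det ‖a_{τt}^{σ_μ s_μ}‖`; a non-vanishing determinant forces the row labels to be pairwise distinct, but with the
   paper's parameters `S = [10.5UV]`, `S₁ = [12DW + 0.5]`, `T = [20.2DVW]`, `T₁ = [4.2U + 0.5]` and its standing
   bounds `U ≥ 1`, `V ≥ 6`, `DW ≥ 2` the printed box has `(S+1)(S₁+1) < L` elements (`box_lt_L`).  The printed PROOF
   (Lemma 2 with `M = 2S₁+1`, `ξ_s = s`) establishes the variant `|s_μ| ≤ S₁`, which is what one should read.
2. Step c) of §6, `deg_Y R ≤ ¼LS₁(T₁+½)` and `deg_{Y⁻¹} R ≤ ¼LS₁(T₁+½)`, is exactly the count for rows with `s_μ ≥ 0`;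
   for the proved range `|s_μ| ≤ S₁` each of the two degrees can reach `LS₁T₁(T₁+1)/(2T₁+1) ≈ ½LS₁(T₁+½)`, so the
   α-height term `½DS₁(T₁+0.5) log A` of (6.6) doubles (Liouville's inequality charges `(N⁺+N⁻)·h(α)` for a Laurent
   polynomial with extreme `Y`-exponents `N⁺, −N⁻`).  The closing budget of d) is razor-thin as printed
   (`31.85 + 20.2 + 10.5 + 22.28 = 84.83 < 84.84 ≤ L/(2DUVW)`); with the honest degree it reads `63.7 + 20.2 + 10.5 +
   22.28 = 116.9 > 84.84` and yields no contradiction: **the printed argument does not establish the constant 211.**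
   (This part is arithmetic on the printed displays; see the lineage file `REPAIR.md` for the line-by-line accounting,
   the honest re-optimisation — minimal constant ≈ 332 with the paper's tools, ≈ 359 with the tree's `ψ(x) ≤ 1.15x` —
   and the repaired parameter scheme for `c₀ = 400`.)
3. The `π` case (`α = −1`, `h(α) = 0`: NW96 Theorem 2, the tree's hypothesis-free `NesterenkoWaldschmidt1996.approx_measure_pi`)
   is unaffected: the doubled term vanishes there.

§4 types the REPAIRED TARGET `NW1996MainR (c : ℝ) : Prop` — the registered text with `211` replaced by `c` — with the
read-back `NesterenkoWaldschmidt1996_thm_1 ↔ NW1996MainR 211` (`Iff.rfl`), monotonicity in `c`, and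
`NesterenkoWaldschmidt1996_thm_1 → NW1996MainR 400`: the tree's `hNW` consumers can be re-typed against the WEAKER
binder `NW1996MainR 400` at zero risk today (it is implied by the registered fact), and that binder is what the
lineage's theorem-lane programme (general interpolation-determinant core = `NWPi.pi_core` with `α` of positive height,
two-sided perturbation, two-variable Liouville; honest parameters) is to discharge hypothesis-free.

No `sorry`, no new axioms, no instances, no notation.  Imports: the registered statement file + two Mathlib leaves.

(PORT by census-1 gen 18 of the lens-6 g22 HOME kernel `NW96Gap.lean` b4420ad3…, 316 l; CLAIM L2084, RULING/FRAME G22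
L2085, NODE L2092 / REQUEST L2093, critic VERDICT L2098 (crit g8: CLEARED — AUDIT ×1, the lineage's first; lens-6
tally THEOREM ×4 + CELL ×3 + AUDIT ×1; PORT GO as ONE Summit-side file `--supports stmt-Schanuel-33364`).  PORT EDITS:
`set_option linter.dupNamespace false` dropped; `def NW1996MainR` moved to the Literature statement file (census ONE-def
proposal) and referenced from here; everything else verbatim.  No census credit carried; rung 0 — nothing here proves
Schanuel, and nothing here asserts that the registered fact is false.)
-/

namespace Summit.Schanuel.Schanuel.Theorems.RootDecomp1KNW96Gap

open Literature.NumberTheory.Transcendental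

/-! ## §1  The printed parameter box of Lemma 6 has fewer than `L` elements -/

/-- With the parameters of NW96 §6 — `S = [10.5UV]`, `S₁ = [12DW + ½]`, `T = [20.2DVW]`, `T₁ = [4.2U + ½]`
(`[·]` = integer part) — and the standing bounds `U ≥ 1`, `V ≥ 6`, `DW ≥ 2` of §6 (there: `U ≥ 1`, `V ≥ 6`,
`W ≥ 2` hence `DW ≥ 2` for `D ≥ 1`), the box `{0,…,S} × {0,…,S₁}` of the printed Lemma 6 has
`(S+1)(S₁+1) < (T+1)(2T₁+1) = L` elements.  (`D` is any real here — only `DW ≥ 2` is used; the paper's `D = [ℚ(α,β):ℚ] ≥ 1` is a special case.)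
Arithmetic: `(S+1)(S₁+1) ≤ (10.5UV+1)(12DW+1.5) = 126DUVW + 15.75UV + 12DW + 1.5 < 169.68 DUVW = 20.2DVW·8.4U
< (T+1)(2T₁+1)`. -/
theorem box_lt_L (D U V W : ℝ) (hU : 1 ≤ U) (hV : 6 ≤ V) (hDW : 2 ≤ D * W) :
    ((⌊(21 / 2 : ℝ) * U * V⌋₊ : ℝ) + 1) * ((⌊12 * D * W + 1 / 2⌋₊ : ℝ) + 1) <
      ((⌊(101 / 5 : ℝ) * D * V * W⌋₊ : ℝ) + 1) * (2 * (⌊(21 / 5 : ℝ) * U + 1 / 2⌋₊ : ℝ) + 1) := by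
  have hUV : 6 ≤ U * V := by nlinarith
  have hW0 : 0 ≤ D * W := by linarith
  have h1 : ((⌊(21 / 2 : ℝ) * U * V⌋₊ : ℝ)) ≤ 21 / 2 * U * V :=
    Nat.floor_le (by positivity)
  have h2 : ((⌊12 * D * W + 1 / 2⌋₊ : ℝ)) ≤ 12 * D * W + 1 / 2 :=
    Nat.floor_le (by nlinarith)
  have h3 : (101 / 5 : ℝ) * D * V * W < (⌊(101 / 5 : ℝ) * D * V * W⌋₊ : ℝ) + 1 :=
    Nat.lt_floor_add_one _
  have h4 : (21 / 5 : ℝ) * U + 1 / 2 < (⌊(21 / 5 : ℝ) * U + 1 / 2⌋₊ : ℝ) + 1 :=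
    Nat.lt_floor_add_one _
  -- abbreviations
  set s := ((⌊(21 / 2 : ℝ) * U * V⌋₊ : ℝ)) with hs
  set s₁ := ((⌊12 * D * W + 1 / 2⌋₊ : ℝ)) with hs₁
  set t := ((⌊(101 / 5 : ℝ) * D * V * W⌋₊ : ℝ)) with ht
  set t₁ := ((⌊(21 / 5 : ℝ) * U + 1 / 2⌋₊ : ℝ)) with ht₁
  have hs0 : 0 ≤ s := Nat.cast_nonneg _
  have hs₁0 : 0 ≤ s₁ := Nat.cast_nonneg _
  have ht0 : 0 ≤ t := Nat.cast_nonneg _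
  have ht₁0 : 0 ≤ t₁ := Nat.cast_nonneg _
  -- upper bound for the box, lower bound for `L`
  have hbox : (s + 1) * (s₁ + 1) ≤ (21 / 2 * U * V + 1) * (12 * D * W + 3 / 2) := by
    apply mul_le_mul <;> linarith
  have hT1 : (42 / 5 : ℝ) * U < 2 * t₁ + 1 := by linarith
  have hL : (101 / 5 : ℝ) * D * V * W * ((42 / 5 : ℝ) * U) < (t + 1) * (2 * t₁ + 1) := by
    have hA : 0 < (101 / 5 : ℝ) * D * V * W := by nlinarith
    calc (101 / 5 : ℝ) * D * V * W * ((42 / 5 : ℝ) * U)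
        < (101 / 5 : ℝ) * D * V * W * (2 * t₁ + 1) := by
          exact mul_lt_mul_of_pos_left hT1 hA
      _ ≤ (t + 1) * (2 * t₁ + 1) := by
          apply mul_le_mul_of_nonneg_right h3.le; linarith
  -- the polynomial inequality `(10.5UV+1)(12DW+1.5) < 169.68·DUVW`
  have hpoly : (21 / 2 * U * V + 1) * (12 * D * W + 3 / 2) <
      (101 / 5 : ℝ) * D * V * W * ((42 / 5 : ℝ) * U) := by
    have hprod : 12 ≤ (U * V) * (D * W) := by nlinarith
    nlinarith [mul_le_mul hUV hDW (by norm_num) (by nlinarith)]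
  calc (s + 1) * (s₁ + 1) ≤ (21 / 2 * U * V + 1) * (12 * D * W + 3 / 2) := hbox
    _ < (101 / 5 : ℝ) * D * V * W * ((42 / 5 : ℝ) * U) := hpoly
    _ < (t + 1) * (2 * t₁ + 1) := hL

/-! ## §2  Pigeonhole: a square matrix whose rows are read off labels from a too-small box is singular -/

/-- Row labels in a box `{0,…,S} × {0,…,S₁}` with `(S+1)(S₁+1) < L` cannot be pairwise distinct. -/
theorem not_injective_of_box {L S S₁ : ℕ} (ρ : Fin L → ℕ × ℕ)
    (hρ : ∀ μ, (ρ μ).1 ≤ S ∧ (ρ μ).2 ≤ S₁) (hL : (S + 1) * (S₁ + 1) < L) :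
    ¬ Function.Injective ρ := by
  intro hinj
  let g : Fin L → Fin (S + 1) × Fin (S₁ + 1) := fun μ =>
    (⟨(ρ μ).1, Nat.lt_succ_of_le (hρ μ).1⟩, ⟨(ρ μ).2, Nat.lt_succ_of_le (hρ μ).2⟩)
  have hg : Function.Injective g := by
    intro μ μ' h
    apply hinj
    have h1 : (ρ μ).1 = (ρ μ').1 := by
      have := congrArg (fun p => (p.1 : ℕ)) h
      simpa [g] using this
    have h2 : (ρ μ).2 = (ρ μ').2 := by
      have := congrArg (fun p => (p.2 : ℕ)) h
      simpa [g] using this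
    exact Prod.ext h1 h2
  have hcard := Fintype.card_le_of_injective g hg
  simp only [Fintype.card_fin, Fintype.card_prod] at hcard
  omega

/-- A square matrix whose `μ`-th row depends only on a label `ρ μ`, with `ρ` not injective, has determinant `0`
(two equal rows). -/
theorem det_eq_zero_of_rowLabels {R : Type*} [CommRing R] {L : ℕ} {κ : Type*}
    (ρ : Fin L → κ) (a : κ → Fin L → R) (h : ¬ Function.Injective ρ) :
    (Matrix.of fun μ ν => a (ρ μ) ν).det = 0 := by
  have : ∃ μ μ', μ ≠ μ' ∧ ρ μ = ρ μ' := by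
    by_contra hcon
    push Not at hcon
    exact h (fun μ μ' hμ => by_contra fun hne => hcon μ μ' hne hμ)
  obtain ⟨μ, μ', hne, heq⟩ := this
  exact Matrix.det_zero_of_row_eq hne (by ext ν; simp [heq])

/-! ## §3  NW96 Lemma 6, as printed, is false -/

/-- **NW96 Lemma 6 as printed is false, for every admissible parameter point and every entry function.**
Let `U ≥ 1`, `V ≥ 6`, `DW ≥ 2` (the standing bounds of §6; `D ≥ 1` is not even needed) and let `S, S₁, T, T₁` be the paper's parameters.
For ANY commutative ring `R`, ANY enumeration of the `L = (T+1)(2T₁+1)` columns `(τ,t)` by `Fin L` and ANY entry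
function `a : (σ,s) ↦ (row of length L)` — in particular the numbers `a_{τt}^{σs}` of (6.3) — and ANY choice of row
labels `(σ_μ, s_μ)`, `1 ≤ μ ≤ L`, inside the PRINTED box `0 ≤ σ_μ ≤ S`, `0 ≤ s_μ ≤ S₁`, the determinant
`det ‖a_{τt}^{σ_μ s_μ}‖` VANISHES.  (The paper's proof yields rows with `|s_μ| ≤ S₁` instead; see the module docstring
for the consequence in step c).) -/
theorem nw1996_lemma6_asPrinted_false {R : Type*} [CommRing R]
    (D : ℕ) (U V W : ℝ) (hU : 1 ≤ U) (hV : 6 ≤ V) (hDW : 2 ≤ (D : ℝ) * W)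
    (S S₁ T T₁ : ℕ) (hS : S = ⌊(21 / 2 : ℝ) * U * V⌋₊) (hS₁ : S₁ = ⌊12 * (D : ℝ) * W + 1 / 2⌋₊)
    (hT : T = ⌊(101 / 5 : ℝ) * D * V * W⌋₊) (hT₁ : T₁ = ⌊(21 / 5 : ℝ) * U + 1 / 2⌋₊)
    (a : ℕ × ℕ → Fin ((T + 1) * (2 * T₁ + 1)) → R)
    (ρ : Fin ((T + 1) * (2 * T₁ + 1)) → ℕ × ℕ) (hρ : ∀ μ, (ρ μ).1 ≤ S ∧ (ρ μ).2 ≤ S₁) :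
    (Matrix.of fun μ ν => a (ρ μ) ν).det = 0 := by
  apply det_eq_zero_of_rowLabels ρ a
  apply not_injective_of_box ρ hρ
  have h := box_lt_L (D : ℝ) U V W hU hV hDW
  rw [← hS, ← hS₁, ← hT, ← hT₁] at h
  exact_mod_cast h

/-- The same with the paper's `D = [ℚ(α, β) : ℚ]` written out (no hypothesis on `α, β` is needed: only `DW ≥ 2`,
`U ≥ 1`, `V ≥ 6` enter). -/
theorem nw1996_lemma6_asPrinted_false_field {R : Type*} [CommRing R]
    (α β : ℂ) (U V W : ℝ) (hU : 1 ≤ U) (hV : 6 ≤ V)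
    (hDW : 2 ≤ (Module.finrank ℚ (IntermediateField.adjoin ℚ ({α, β} : Set ℂ)) : ℝ) * W)
    (S S₁ T T₁ : ℕ) (hS : S = ⌊(21 / 2 : ℝ) * U * V⌋₊)
    (hS₁ : S₁ = ⌊12 * (Module.finrank ℚ (IntermediateField.adjoin ℚ ({α, β} : Set ℂ)) : ℝ) * W + 1 / 2⌋₊)
    (hT : T = ⌊(101 / 5 : ℝ) * (Module.finrank ℚ (IntermediateField.adjoin ℚ ({α, β} : Set ℂ)) : ℝ) * V * W⌋₊)
    (hT₁ : T₁ = ⌊(21 / 5 : ℝ) * U + 1 / 2⌋₊)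
    (a : ℕ × ℕ → Fin ((T + 1) * (2 * T₁ + 1)) → R)
    (ρ : Fin ((T + 1) * (2 * T₁ + 1)) → ℕ × ℕ) (hρ : ∀ μ, (ρ μ).1 ≤ S ∧ (ρ μ).2 ≤ S₁) :
    (Matrix.of fun μ ν => a (ρ μ) ν).det = 0 :=
  nw1996_lemma6_asPrinted_false _ U V W hU hV hDW S S₁ T T₁ hS hS₁ hT hT₁ a ρ hρ

/-! ## §4  The repaired target, typed: `NW1996MainR c`

PORT NOTE (census-1 gen 18): the parametrised def `Literature.NumberTheory.Transcendental.NW1996MainR (c : ℝ) : Prop`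
now lives NEXT TO the registered fact in `Literature/NumberTheory/Transcendental/ExpLogSimultaneousApproximationMeasure.lean`
(ONE source of truth, critic RULING L2085 (R3) / VERDICT L2098); the read-back, the monotonicity and the two
comparison arrows below refer to it through `open Literature.NumberTheory.Transcendental`. -/

/-- Read-back: the registered fact IS `NW1996MainR 211`, definitionally. -/
theorem thm_1_iff_mainR : NesterenkoWaldschmidt1996_thm_1 ↔ NW1996MainR 211 := Iff.rfl

/-- The three bracketed factors of the exponent are non-negative under the hypotheses of the theorem (so the bound is
monotone in the constant).  `W`-factor: `log B ≥ h(β) ≥ 0`, `log log A ≥ −log D` (as `log A ≥ 1/D`), `log D ≥ 0`,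
`log(E|θ|₊) ≥ 1`; `V`-factor: `log A > 0`; `U`-factor: `log(D+2) > 0`, `log E ≥ 1`. -/
theorem exponent_nonneg (θ α β : ℂ) (A B E : ℝ) (hα : IsAlgebraic ℚ α) (hβ : IsAlgebraic ℚ β)
    (hE : Real.exp 1 ≤ E)
    (hAh : max (weilHeight₁ (IntermediateField.adjoin ℚ ({α, β} : Set ℂ)) (fun _ : Unit => α))
          (1 / (Module.finrank ℚ (IntermediateField.adjoin ℚ ({α, β} : Set ℂ)) : ℝ)) ≤ Real.log A)
    (hBh : weilHeight₁ (IntermediateField.adjoin ℚ ({α, β} : Set ℂ)) (fun _ : Unit => β) ≤ Real.log B) :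
    0 ≤ (Module.finrank ℚ (IntermediateField.adjoin ℚ ({α, β} : Set ℂ)) : ℝ) *
          (Real.log B + Real.log (Real.log A) +
            4 * Real.log (Module.finrank ℚ (IntermediateField.adjoin ℚ ({α, β} : Set ℂ)) : ℝ) +
            2 * Real.log (E * max 1 ‖θ‖) + 10) *
          ((Module.finrank ℚ (IntermediateField.adjoin ℚ ({α, β} : Set ℂ)) : ℝ) * Real.log A +
            2 * E * ‖θ‖ + 6 * Real.log E) *
          ((33 / 10 : ℝ) * (Module.finrank ℚ (IntermediateField.adjoin ℚ ({α, β} : Set ℂ)) : ℝ) *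
              Real.log ((Module.finrank ℚ (IntermediateField.adjoin ℚ ({α, β} : Set ℂ)) : ℝ) + 2) +
            Real.log E) /
          Real.log E ^ 2 := by
  set K := IntermediateField.adjoin ℚ ({α, β} : Set ℂ) with hK
  haveI hKfd : FiniteDimensional ℚ K := by
    refine IntermediateField.finiteDimensional_adjoin (fun x hx => ?_)
    simp only [Set.mem_insert_iff, Set.mem_singleton_iff] at hx
    rcases hx with rfl | rfl
    · exact isAlgebraic_iff_isIntegral.mp hα
    · exact isAlgebraic_iff_isIntegral.mp hβ
  set D : ℕ := Module.finrank ℚ K with hD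
  have hDpos : 0 < D := Module.finrank_pos
  have hD1 : (1 : ℝ) ≤ D := by exact_mod_cast hDpos
  have hD0 : (0 : ℝ) < D := by linarith
  have hE1 : 1 < E := lt_of_lt_of_le (by have := Real.add_one_le_exp (1 : ℝ); linarith) hE
  have hlogE : 1 ≤ Real.log E := by
    have := Real.log_le_log (Real.exp_pos 1) hE
    simpa using this
  have hlogD : 0 ≤ Real.log (D : ℝ) := Real.log_nonneg hD1
  -- `log A ≥ 1/D > 0`, `log log A ≥ -log D`
  have hAD : 1 / (D : ℝ) ≤ Real.log A := le_trans (le_max_right _ _) hAh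
  have hinvD : 0 < 1 / (D : ℝ) := by positivity
  have hlogA : 0 < Real.log A := lt_of_lt_of_le hinvD hAD
  have hllA : -Real.log (D : ℝ) ≤ Real.log (Real.log A) := by
    have h1 : Real.log (1 / (D : ℝ)) ≤ Real.log (Real.log A) := Real.log_le_log hinvD hAD
    have h2 : Real.log (1 / (D : ℝ)) = -Real.log (D : ℝ) := by
      rw [one_div, Real.log_inv]
    linarith
  -- `log B ≥ h(β) ≥ 0`
  have hlogB : 0 ≤ Real.log B := le_trans (weilHeight₁_nonneg K _) hBh
  -- `log (E · max 1 |θ|) ≥ log E ≥ 1`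
  have hmax1 : 1 ≤ max 1 ‖θ‖ := le_max_left _ _
  have hEθ : 1 ≤ Real.log (E * max 1 ‖θ‖) := by
    have hle : E ≤ E * max 1 ‖θ‖ := by
      have := mul_le_mul_of_nonneg_left hmax1 (le_of_lt (lt_trans zero_lt_one hE1))
      simpa using this
    have := Real.log_le_log (lt_trans zero_lt_one hE1) hle
    linarith
  have hW : 0 ≤ Real.log B + Real.log (Real.log A) + 4 * Real.log (D : ℝ) +
      2 * Real.log (E * max 1 ‖θ‖) + 10 := by linarith
  have hV : 0 ≤ (D : ℝ) * Real.log A + 2 * E * ‖θ‖ + 6 * Real.log E := by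
    have : 0 ≤ ‖θ‖ := norm_nonneg _
    have : 0 ≤ 2 * E * ‖θ‖ := by
      have : 0 ≤ E := le_of_lt (lt_trans zero_lt_one hE1)
      positivity
    nlinarith
  have hU : 0 ≤ (33 / 10 : ℝ) * D * Real.log ((D : ℝ) + 2) + Real.log E := by
    have : 0 ≤ Real.log ((D : ℝ) + 2) := Real.log_nonneg (by linarith)
    positivity
  have hnum : 0 ≤ (D : ℝ) * (Real.log B + Real.log (Real.log A) + 4 * Real.log (D : ℝ) +
      2 * Real.log (E * max 1 ‖θ‖) + 10) * ((D : ℝ) * Real.log A + 2 * E * ‖θ‖ + 6 * Real.log E) *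
      ((33 / 10 : ℝ) * D * Real.log ((D : ℝ) + 2) + Real.log E) := by
    have h1 := mul_nonneg (le_of_lt hD0) hW
    have h2 := mul_nonneg h1 hV
    exact mul_nonneg h2 hU
  exact div_nonneg hnum (by positivity)

/-- `NW1996MainR` is monotone in the constant: a larger constant is a weaker statement. -/
theorem NW1996MainR.mono {c c' : ℝ} (hcc' : c ≤ c') (h : NW1996MainR c) : NW1996MainR c' := by
  intro θ α β A B E hθ hα0 hβ0 hα hβ hA hB hE hAh hBh
  refine le_trans ?_ (h θ α β A B E hθ hα0 hβ0 hα hβ hA hB hE hAh hBh)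
  apply Real.exp_le_exp.mpr
  have hX := exponent_nonneg θ α β A B E hα hβ hE hAh hBh
  -- `-(c' X) ≤ -(c X)` for `X ≥ 0`
  have key : c * ((Module.finrank ℚ (IntermediateField.adjoin ℚ ({α, β} : Set ℂ)) : ℝ) *
          (Real.log B + Real.log (Real.log A) +
            4 * Real.log (Module.finrank ℚ (IntermediateField.adjoin ℚ ({α, β} : Set ℂ)) : ℝ) +
            2 * Real.log (E * max 1 ‖θ‖) + 10) *
          ((Module.finrank ℚ (IntermediateField.adjoin ℚ ({α, β} : Set ℂ)) : ℝ) * Real.log A +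
            2 * E * ‖θ‖ + 6 * Real.log E) *
          ((33 / 10 : ℝ) * (Module.finrank ℚ (IntermediateField.adjoin ℚ ({α, β} : Set ℂ)) : ℝ) *
              Real.log ((Module.finrank ℚ (IntermediateField.adjoin ℚ ({α, β} : Set ℂ)) : ℝ) + 2) +
            Real.log E) /
          Real.log E ^ 2) ≤
      c' * ((Module.finrank ℚ (IntermediateField.adjoin ℚ ({α, β} : Set ℂ)) : ℝ) *
          (Real.log B + Real.log (Real.log A) +
            4 * Real.log (Module.finrank ℚ (IntermediateField.adjoin ℚ ({α, β} : Set ℂ)) : ℝ) +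
            2 * Real.log (E * max 1 ‖θ‖) + 10) *
          ((Module.finrank ℚ (IntermediateField.adjoin ℚ ({α, β} : Set ℂ)) : ℝ) * Real.log A +
            2 * E * ‖θ‖ + 6 * Real.log E) *
          ((33 / 10 : ℝ) * (Module.finrank ℚ (IntermediateField.adjoin ℚ ({α, β} : Set ℂ)) : ℝ) *
              Real.log ((Module.finrank ℚ (IntermediateField.adjoin ℚ ({α, β} : Set ℂ)) : ℝ) + 2) +
            Real.log E) /
          Real.log E ^ 2) := mul_le_mul_of_nonneg_right hcc' hX
  -- reassociate: the registered text is `c * D * W * V * U / log²E`, i.e. left-associated products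
  have e1 : ∀ (k : ℝ) (d w v u l : ℝ), k * d * w * v * u / l = k * (d * w * v * u / l) := by
    intro k d w v u l; ring
  rw [e1, e1]
  linarith [key]

/-- The registered fact implies the repaired target `NW1996MainR 400` (so re-typing a consumer's binder from
`NesterenkoWaldschmidt1996_thm_1` to `NW1996MainR 400` loses nothing today). -/
theorem mainR_400_of_thm_1 (h : NesterenkoWaldschmidt1996_thm_1) : NW1996MainR 400 :=
  NW1996MainR.mono (by norm_num) (thm_1_iff_mainR.mp h)

/-- Conversely any constant `c ≤ 211` would give the registered fact back. -/
theorem thm_1_of_mainR {c : ℝ} (hc : c ≤ 211) (h : NW1996MainR c) : NesterenkoWaldschmidt1996_thm_1 :=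
  thm_1_iff_mainR.mpr (NW1996MainR.mono hc h)

end Summit.Schanuel.Schanuel.Theorems.RootDecomp1KNW96Gap
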